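import Summits.CriticalPhenomena.PercolationContinuityZ3.Theorems.PercNearOneGluingNoHeavyLowerTailSahiE3PatternCertificate
import Mathlib.Tactic.Linarith
import Mathlib.Tactic.Ring
import Mathlib.Tactic.Positivity
import HarnessLib
import HarnessLib.Audit

/-!
# `NoHeavyLowerTail` (crux stmt-CriticalPhenomena-4575), Sahi programme P4 (Holley / monotone coupling):
# an OBSTRUCTION to flow certificates — pinned families

Support file (cell `prim-l12`, seat P4, generation 12; `--supports stmt-CriticalPhenomena-4575`).  No named facts, no sorries;
standard axioms; def-free.

The kernel theorem `…SahiE3PatternCertificate.phi_nonneg_of_patternCertificate` (generation 8) derives Sahi's `Z³E₃ ≥ 0` for a slot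
`U ⊆ P` of a finite pattern from a FLOW CERTIFICATE `(R, F)`: conditions (R0), (F0), (F≤), (cap), (K), (pair).  Generations 6–11 of
this programme proved Sahi's `C₃` / Kahn's Conjecture 5 for many first slots by exhibiting such certificates, and the certificate LP
was found feasible on every pattern of `2ᵏ`, `k ≤ 5`.  THIS FILE records the first general OBSTRUCTION to the method:

THEOREM `no_certificate_of_pinnedFamily`.  Write `Z = Σ ν`, `N_U = Σ_U ν`, `N_D = Σ_{Uᶜ} ν` and, for up-sets `S, T`,
`need(S,T) = Z(ν(S)ν(T∩U) + ν(T)ν(S∩U)) − N_U ν(S)ν(T)`, `Y = S∩T∩U`, `X = S∩T∩Uᶜ`.  For EVERY certificate and every pair of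
up-sets one has the sandwich `need(S,T) ≤ R(Y) + K(X) ≤ Z(Z+N_D)ν(Y) − Z·N_U·ν(X)` (`K(s) = Σ_t F t s − Z N_U ν_s ≥ 0`; lemma
`sandwich_upper`: sum (cap) over `Y`, every donor of a receiver in `X` lies in `Y`).  Hence if a finite family of up-set pairs
`(Sᵢ,Tᵢ)` is PINNED — `need(Sᵢ,Tᵢ) = Z(Z+N_D)ν(Yᵢ) − Z N_U ν(Xᵢ)` for each `i` — then `R(Yᵢ) + K(Xᵢ) = need(Sᵢ,Tᵢ)` for
every certificate, and any real coefficients `cᵢ` with `Σᵢ cᵢ·1_{Sᵢ∩Tᵢ} ≥ 0` pointwise force `Σᵢ cᵢ·need(Sᵢ,Tᵢ) ≥ 0`.  So a pinned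
family with `Σᵢ cᵢ 1_{Sᵢ∩Tᵢ} ≥ 0` and `Σᵢ cᵢ need(Sᵢ,Tᵢ) < 0` proves that NO certificate exists.

APPLICATION (HOME prim-l12-p4/FROM-prim-l12-p4-gen12-CERTIFICATE-OBSTRUCTION.md, exact scripts code/gen12/cnf_sym_exact.py,
cnf_brute.py): for the READ-ONCE CNF `U = (x₁∨x₂)∧(x₃∨x₄)∧…∧(x₂ₘ₋₁∨x₂ₘ)` under `Bernoulli(p)^{⊗2m}` the `2^m` pairs
`(∧_{i∈B} x_{2i−1}, ∧_{i∈B} x_{2i})`, `B ⊆ [m]`, are pinned (both bounds equal `p^{2|B|}(2c^{m−|B|} − c^m)`, `c = 1−(1−p)²`;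
they are independence zeros of `E₃`), the Möbius coefficients `c_B = (−1)^{|B|}` give `Σ_B c_B 1_{S_B∩T_B} = 1_{no clause at 11} ≥ 0`
and `Σ_B c_B need_B = (2p(1−p))^m(2 − ((2−p)(1+p)/2)^m)`, which is NEGATIVE iff `((2−p)(1+p)/2)^m > 2` — e.g. `p = ½, m ≥ 6`:
on `2¹²` with the uniform measure the value is `−7153/2²⁴` (in counts `2³¹ − 3¹²·2¹²`).  Consequently the certificate method
(equivalently the crossing-family inequality MIX of generation 11) cannot reach all read-once first slots; Sahi's `C₃` itself is
not refuted there.  The concrete instance is recorded numerically (not in this file); this file is the reusable tool.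
-/

namespace Summit.CriticalPhenomena.PercolationContinuityZ3.Theorems.SahiE3CertificateObstruction

open Finset
open scoped BigOperators

variable {P : Type*} [Fintype P] [DecidableEq P] [PartialOrder P]

omit [PartialOrder P] in
/-- Splitting a sum over `S` into its parts inside and outside `U`. [folklore] -/
theorem sum_split (U S : Finset P) (f : P → ℝ) :
    ∑ t ∈ S, f t = ∑ t ∈ S ∩ U, f t + ∑ t ∈ S ∩ Uᶜ, f t := by
  rw [← Finset.sum_filter_add_sum_filter_not S (fun t => t ∈ U) f, Finset.filter_mem_eq_inter]
  congr 1
  refine Finset.sum_congr ?_ fun _ _ => rfl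
  ext t; simp [Finset.mem_inter, Finset.mem_filter]

/-- **Upper half of the sandwich.**  For a flow certificate (only (F0), (F≤), (cap) are used) and up-sets `S, T`:
`R(S∩T∩U) + Σ_{s∈S∩T∩Uᶜ} Σ_{t∈U} F t s ≤ Z(Z+N_D)·ν(S∩T∩U)` — sum (cap) over `Y = S∩T∩U` and note that every donor `t`
of a receiver `s ∈ S∩T` (i.e. `F t s ≠ 0`, so `s ≤ t`) lies in the up-set `S∩T`. [this work] -/
theorem sandwich_upper (U : Finset P) (ν R : P → ℝ) (F : P → P → ℝ)
    (hF0 : ∀ t s, 0 ≤ F t s) (hFle : ∀ t s, F t s ≠ 0 → s ≤ t)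
    (hcap : ∀ t ∈ U, R t + ∑ s ∈ Uᶜ, F t s ≤ (∑ r, ν r) * ((∑ r, ν r) + ∑ r ∈ Uᶜ, ν r) * ν t)
    {S T : Finset P} (hS : IsUpperSet (S : Set P)) (hT : IsUpperSet (T : Set P)) :
    ∑ t ∈ (S ∩ T) ∩ U, R t + ∑ s ∈ (S ∩ T) ∩ Uᶜ, ∑ t ∈ U, F t s ≤
      (∑ r, ν r) * ((∑ r, ν r) + ∑ r ∈ Uᶜ, ν r) * ∑ t ∈ (S ∩ T) ∩ U, ν t := by
  -- sum the caps over `Y`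
  have h1 : ∑ t ∈ (S ∩ T) ∩ U, (R t + ∑ s ∈ Uᶜ, F t s) ≤
      ∑ t ∈ (S ∩ T) ∩ U, (∑ r, ν r) * ((∑ r, ν r) + ∑ r ∈ Uᶜ, ν r) * ν t :=
    Finset.sum_le_sum fun t ht => hcap t (Finset.mem_inter.1 ht).2
  rw [← Finset.mul_sum, Finset.sum_add_distrib] at h1
  -- the flow out of `Y` dominates the flow into `X`
  have h2 : ∑ s ∈ (S ∩ T) ∩ Uᶜ, ∑ t ∈ U, F t s ≤ ∑ t ∈ (S ∩ T) ∩ U, ∑ s ∈ Uᶜ, F t s := by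
    have e1 : ∑ s ∈ (S ∩ T) ∩ Uᶜ, ∑ t ∈ U, F t s = ∑ s ∈ (S ∩ T) ∩ Uᶜ, ∑ t ∈ (S ∩ T) ∩ U, F t s := by
      refine Finset.sum_congr rfl fun s hs => ?_
      rw [← Finset.sum_filter_add_sum_filter_not U (fun t => t ∈ S ∩ T)]
      have hz : ∑ t ∈ U.filter (fun t => ¬ t ∈ S ∩ T), F t s = 0 := by
        refine Finset.sum_eq_zero fun t ht => ?_
        rw [Finset.mem_filter] at ht
        by_contra h0
        have hst : s ≤ t := hFle t s h0
        have hsST : s ∈ S ∩ T := (Finset.mem_inter.1 hs).1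
        apply ht.2
        rw [Finset.mem_inter] at hsST ⊢
        exact ⟨hS hst hsST.1, hT hst hsST.2⟩
      rw [hz, add_zero, Finset.filter_mem_eq_inter, Finset.inter_comm]
    rw [e1, Finset.sum_comm]
    refine Finset.sum_le_sum fun t _ => ?_
    exact Finset.sum_le_sum_of_subset_of_nonneg (Finset.inter_subset_right) fun s _ _ => hF0 t s
  linarith

/-- **Pinned families obstruct flow certificates.**  Let `U ⊆ P` be a slot with masses `ν`, and `(Sᵢ, Tᵢ)_{i∈s}` up-set pairs
which are PINNED: `need(Sᵢ,Tᵢ) = Z(Z+N_D)ν(Sᵢ∩Tᵢ∩U) − Z N_U ν(Sᵢ∩Tᵢ∩Uᶜ)`.  If real coefficients `cᵢ` satisfy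
`Σᵢ cᵢ 1[t ∈ Sᵢ∩Tᵢ] ≥ 0` for every `t` and `Σᵢ cᵢ need(Sᵢ,Tᵢ) < 0`, then there is NO flow certificate `(R, F)` for `(U, ν)`
(conditions (R0), (F0), (F≤), (cap), (K), (pair) of `…SahiE3PatternCertificate.phi_nonneg_of_patternCertificate`).
Proof: the sandwich pins `R(Yᵢ) + K(Xᵢ) = need(Sᵢ,Tᵢ)`, and `R, K ≥ 0`. [this work] -/
theorem no_certificate_of_pinnedFamily (U : Finset P) (ν : P → ℝ) {ι : Type*} (s : Finset ι)
    (S T : ι → Finset P) (c : ι → ℝ)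
    (hS : ∀ i ∈ s, IsUpperSet (S i : Set P)) (hT : ∀ i ∈ s, IsUpperSet (T i : Set P))
    (hpin : ∀ i ∈ s,
      (∑ r, ν r) * ((∑ t ∈ S i, ν t) * (∑ t ∈ T i ∩ U, ν t) + (∑ t ∈ T i, ν t) * (∑ t ∈ S i ∩ U, ν t))
          - (∑ r ∈ U, ν r) * (∑ t ∈ S i, ν t) * (∑ t ∈ T i, ν t) =
        (∑ r, ν r) * ((∑ r, ν r) + ∑ r ∈ Uᶜ, ν r) * (∑ t ∈ (S i ∩ T i) ∩ U, ν t)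
          - (∑ r, ν r) * (∑ r ∈ U, ν r) * (∑ t ∈ (S i ∩ T i) ∩ Uᶜ, ν t))
    (hc : ∀ t, 0 ≤ ∑ i ∈ s, c i * (if t ∈ S i ∩ T i then 1 else 0))
    (hneg : ∑ i ∈ s, c i * ((∑ r, ν r) * ((∑ t ∈ S i, ν t) * (∑ t ∈ T i ∩ U, ν t)
        + (∑ t ∈ T i, ν t) * (∑ t ∈ S i ∩ U, ν t)) - (∑ r ∈ U, ν r) * (∑ t ∈ S i, ν t) * (∑ t ∈ T i, ν t)) < 0) :
    ¬ ∃ (R : P → ℝ) (F : P → P → ℝ),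
      (∀ t ∈ U, 0 ≤ R t) ∧ (∀ t s, 0 ≤ F t s) ∧ (∀ t s, F t s ≠ 0 → s ≤ t) ∧
      (∀ t ∈ U, R t + ∑ s ∈ Uᶜ, F t s ≤ (∑ r, ν r) * ((∑ r, ν r) + ∑ r ∈ Uᶜ, ν r) * ν t) ∧
      (∀ s ∈ Uᶜ, (∑ r, ν r) * (∑ r ∈ U, ν r) * ν s ≤ ∑ t ∈ U, F t s) ∧
      (∀ S S' : Finset P, IsUpperSet (S : Set P) → IsUpperSet (S' : Set P) →
        (∑ r, ν r) * ((∑ t ∈ S, ν t) * (∑ t ∈ S' ∩ U, ν t) + (∑ t ∈ S', ν t) * (∑ t ∈ S ∩ U, ν t))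
            - (∑ r ∈ U, ν r) * (∑ t ∈ S, ν t) * (∑ t ∈ S', ν t)
          ≤ ∑ t ∈ (S ∩ S') ∩ U, R t + ∑ s ∈ (S ∩ S') ∩ Uᶜ, (∑ t ∈ U, F t s - (∑ r, ν r) * (∑ r ∈ U, ν r) * ν s)) := by
  rintro ⟨R, F, hR0, hF0, hFle, hcap, hK, hpair⟩
  set Z := ∑ r, ν r with hZ
  set NU := ∑ r ∈ U, ν r with hNU
  -- the pointwise weight: `R` on `U`, `K` on `Uᶜ`; both nonnegative
  set w : P → ℝ := fun t => if t ∈ U then R t else (∑ t' ∈ U, F t' t - Z * NU * ν t) with hw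
  have hw0 : ∀ t, 0 ≤ w t := by
    intro t
    by_cases ht : t ∈ U
    · simp only [hw, ht, ↓reduceIte]; exact hR0 t ht
    · simp only [hw, ht, ↓reduceIte]
      exact sub_nonneg.2 (hK t (Finset.mem_compl.2 ht))
  -- `R(Y) + K(X) = Σ_{S∩T} w`
  have hsum : ∀ X : Finset P, ∑ t ∈ X ∩ U, R t + ∑ t ∈ X ∩ Uᶜ, (∑ t' ∈ U, F t' t - Z * NU * ν t) = ∑ t ∈ X, w t := by
    intro X
    rw [sum_split U X w]
    congr 1
    · exact Finset.sum_congr rfl fun t ht => by simp only [hw, (Finset.mem_inter.1 ht).2, ↓reduceIte]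
    · refine Finset.sum_congr rfl fun t ht => ?_
      have : t ∉ U := Finset.mem_compl.1 (Finset.mem_inter.1 ht).2
      simp only [hw, this, ↓reduceIte]
  -- pinning: `Σ_{Sᵢ∩Tᵢ} w = needᵢ`
  have hpinned : ∀ i ∈ s, ∑ t ∈ S i ∩ T i, w t =
      Z * ((∑ t ∈ S i, ν t) * (∑ t ∈ T i ∩ U, ν t) + (∑ t ∈ T i, ν t) * (∑ t ∈ S i ∩ U, ν t))
        - NU * (∑ t ∈ S i, ν t) * (∑ t ∈ T i, ν t) := by
    intro i hi
    have lo := hpair (S i) (T i) (hS i hi) (hT i hi)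
    have up := sandwich_upper U ν R F hF0 hFle hcap (hS i hi) (hT i hi)
    have e := hsum (S i ∩ T i)
    have hKsplit : ∑ t ∈ (S i ∩ T i) ∩ Uᶜ, (∑ t' ∈ U, F t' t - Z * NU * ν t) =
        ∑ t ∈ (S i ∩ T i) ∩ Uᶜ, ∑ t' ∈ U, F t' t - Z * NU * ∑ t ∈ (S i ∩ T i) ∩ Uᶜ, ν t := by
      rw [Finset.sum_sub_distrib, ← Finset.mul_sum]
    have hp := hpin i hi
    rw [← e]
    apply le_antisymm
    · rw [hKsplit]; linarith
    · exact lo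
  -- the signed combination
  have key : ∑ i ∈ s, c i * (∑ t ∈ S i ∩ T i, w t) = ∑ t, w t * ∑ i ∈ s, c i * (if t ∈ S i ∩ T i then 1 else 0) := by
    have e1 : ∀ i ∈ s, c i * ∑ t ∈ S i ∩ T i, w t = ∑ t, w t * (c i * (if t ∈ S i ∩ T i then 1 else 0)) := by
      intro i _
      rw [Finset.mul_sum, ← Finset.sum_filter_add_sum_filter_not univ (fun t => t ∈ S i ∩ T i)]
      have hz : ∑ t ∈ univ.filter (fun t => ¬ t ∈ S i ∩ T i), w t * (c i * (if t ∈ S i ∩ T i then 1 else 0)) = 0 :=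
        Finset.sum_eq_zero fun t ht => by
          rw [Finset.mem_filter] at ht; simp [ht.2]
      rw [hz, add_zero, Finset.filter_mem_eq_inter, Finset.univ_inter]
      exact Finset.sum_congr rfl fun t ht => by rw [if_pos ht]; ring
    rw [Finset.sum_congr rfl e1, Finset.sum_comm]
    exact Finset.sum_congr rfl fun t _ => by rw [Finset.mul_sum]
  have hnn : 0 ≤ ∑ i ∈ s, c i * (∑ t ∈ S i ∩ T i, w t) := by
    rw [key]; exact Finset.sum_nonneg fun t _ => mul_nonneg (hw0 t) (hc t)
  have heq : ∑ i ∈ s, c i * (∑ t ∈ S i ∩ T i, w t) = ∑ i ∈ s, c i * (Z * ((∑ t ∈ S i, ν t) * (∑ t ∈ T i ∩ U, ν t)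
      + (∑ t ∈ T i, ν t) * (∑ t ∈ S i ∩ U, ν t)) - NU * (∑ t ∈ S i, ν t) * (∑ t ∈ T i, ν t)) :=
    Finset.sum_congr rfl fun i hi => by rw [hpinned i hi]
  rw [heq] at hnn
  exact absurd hneg (not_lt.2 hnn)

end Summit.CriticalPhenomena.PercolationContinuityZ3.Theorems.SahiE3CertificateObstruction
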